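import Mathlib
import Literature.LinearAlgebra.Matrix.SchurTriangularization
import HarnessLib

/-!
# `FunctorialPrimitivitySplit.PolynomialFunctorTransport` — part I: the characteristic polynomial
# of a polynomial functor `r : ∏ᵢ GL_{aᵢ}(ℂ) → GL_n(ℂ)` at `g` only sees the eigenvalues of `g`

Pure linear algebra for the proof of the support item stmt-Langlands-28168
(`Summit.Langlands.Langlands.Theses.FunctorialPrimitivitySplit.PolynomialFunctorTransport`).

Throughout, `r : (∏ᵢ M_{aᵢ}(ℂ)) → M_n(ℂ)` is a map with POLYNOMIAL entries
(`r M s t = eval (entries of M) (P s t)`), `r 1 = 1`, multiplicative on tuples of invertible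
matrices — exactly the hypothesis of the item.  No definition is introduced: `r`, `P` and the
three hypotheses are carried as binders.

* `charpoly_conj_of_mul_eq_one` — `charpoly (A (B C)) = charpoly B` when `C A = 1`
  (Mathlib `Matrix.charpoly_mul_comm`).
* `charpoly_apply_eq_of_blockTriangular` — **torus degeneration**: for invertible upper
  triangular `Tᵢ`, `charpoly (r T) = charpoly (r (diag Tᵢ)ᵢ)`.  Proof: the one-parameter family
  `Mᵢ(t)_{jl} = T_{i,jl} t^{l-j}` is `D(t)⁻¹ Tᵢ D(t)` (`D(t) = diag(t^j)`) for `t ≠ 0` and is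
  `diag(T_{i,jj})` at `t = 0`; the coefficients of `charpoly (r (M(t)))` are polynomials in `t`
  (Mathlib `Matrix.charpoly_map` along `ℂ[t] → ℂ`, `t ↦ t₀`) which are constant on `ℂ ∖ {0}`
  (conjugation invariance through `r (D⁻¹) r(T) r(D)`), hence constant
  (`Polynomial.eq_zero_of_infinite_isRoot`).
* `charpoly_apply_eq_charpoly_apply_diagonal` — for invertible `gᵢ` with eigenvalues listed (with
  multiplicity, in ANY order) by `dᵢ`, `charpoly (r g) = charpoly (r (diagonal dᵢ)ᵢ)`: Schur
  triangularization with prescribed diagonal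
  (`Literature.LinearAlgebra.Matrix.exists_unitaryGroup_conj_upperTriangular_of_roots_eq`,
  Horn–Johnson Thm. 2.3.1) and the previous two lemmas.
* `charpoly_inv_eq_prod_roots` — for invertible `A ∈ M_m(ℂ)`,
  `charpoly A⁻¹ = ∏_{b ∈ roots (charpoly A)} (X - b⁻¹)` (Schur form again; the inverse of an
  invertible upper triangular matrix is upper triangular with inverse diagonal).
* `map_apply_transport`, `transport_one`, `transport_mul` — transport of `r` along a ring
  isomorphism `ι : L ≃+* ℂ`: the map `r_L` with entries `eval (entries) (ι⁻¹ P)` satisfies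
  `ι (r_L M) = r (ι M)`, `r_L 1 = 1` and is multiplicative on invertible tuples.

References: Horn–Johnson, *Matrix Analysis* (2nd ed.), Thm. 2.3.1 [HornJohnson2013];
J. A. Green, *Polynomial representations of `GL_n`*, LNM 830 (1980), §2.6 (characters of
polynomial representations are symmetric functions of the eigenvalues).
-/

noncomputable section

set_option linter.dupNamespace false

open scoped Matrix Polynomial
open Polynomial Matrix

namespace Summit.Langlands.Langlands.Theorems.PolynomialFunctorTransportKit

variable {k : ℕ} {a : Fin k → ℕ} {n : ℕ}

/-- `charpoly (A * (B * C)) = charpoly B` whenever `C * A = 1` (square matrices over a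
commutative ring; Mathlib `Matrix.charpoly_mul_comm`). [folklore] -/
theorem charpoly_conj_of_mul_eq_one {R : Type*} [CommRing R] {m : Type*} [Fintype m]
    [DecidableEq m] (A B C : Matrix m m R) (h : C * A = 1) :
    (A * (B * C)).charpoly = B.charpoly := by
  rw [Matrix.charpoly_mul_comm, mul_assoc, h, mul_one]

/-- Any multiset of cardinality `m` is listed, with multiplicity, by some `d : Fin m → X`. [folklore] -/
theorem exists_univ_val_map_eq {X : Type*} (s : Multiset X) {m : ℕ} (hs : Multiset.card s = m) :
    ∃ d : Fin m → X, Finset.univ.val.map d = s := by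
  induction s using Quotient.inductionOn with
  | h l =>
    change (l : Multiset X).card = m at hs
    rw [Multiset.coe_card] at hs
    subst hs
    exact ⟨l.get, by rw [Fin.univ_val_map, List.ofFn_get]; rfl⟩

/-- **Torus degeneration.**  Let `r` have polynomial entries, `r 1 = 1`, and be multiplicative on
invertible tuples.  If every `Tᵢ` is invertible and upper triangular then
`charpoly (r T) = charpoly (r (diag (T_{i,jj})ⱼ)ᵢ)`: the family `Mᵢ(t)_{jl} = T_{i,jl} t^{l-j}`
interpolates between `T` (`t = 1`) and its diagonal (`t = 0`) inside the conjugacy class of `T`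
for `t ≠ 0`, and the coefficients of `charpoly (r (M t))` are polynomial in `t`.
[cite: HornJohnson2013, Thm. 2.3.1] -/
theorem charpoly_apply_eq_of_blockTriangular
    (P : Fin n → Fin n → MvPolynomial ((i : Fin k) × (Fin (a i) × Fin (a i))) ℂ)
    (r : ((i : Fin k) → Matrix (Fin (a i)) (Fin (a i)) ℂ) → Matrix (Fin n) (Fin n) ℂ)
    (hr : ∀ (M : (i : Fin k) → Matrix (Fin (a i)) (Fin (a i)) ℂ) (s t : Fin n),
      r M s t = MvPolynomial.eval (fun x => M x.1 x.2.1 x.2.2) (P s t))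
    (h1 : r 1 = 1)
    (hmul : ∀ M N : (i : Fin k) → Matrix (Fin (a i)) (Fin (a i)) ℂ,
      (∀ i, IsUnit (M i)) → (∀ i, IsUnit (N i)) → r (M * N) = r M * r N)
    (T : (i : Fin k) → Matrix (Fin (a i)) (Fin (a i)) ℂ)
    (hT : ∀ i, (T i).BlockTriangular id) (hTu : ∀ i, IsUnit (T i)) :
    (r T).charpoly = (r fun i => Matrix.diagonal fun j => T i j j).charpoly := by
  classical
  -- the one-parameter family `M t`
  set M : ℂ → ((i : Fin k) → Matrix (Fin (a i)) (Fin (a i)) ℂ) :=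
    fun t i => Matrix.of fun j l => T i j l * t ^ (l.val - j.val) with hM
  have hM1 : M 1 = T := by
    funext i; ext j l; simp [hM]
  have hM0 : M 0 = fun i => Matrix.diagonal fun j => T i j j := by
    funext i; ext j l
    simp only [hM, Matrix.of_apply, Matrix.diagonal_apply]
    by_cases hjl : j = l
    · subst hjl; simp
    · rcases lt_or_gt_of_ne hjl with h | h
      · have hne : l.val - j.val ≠ 0 := Nat.sub_ne_zero_of_lt h
        simp [zero_pow hne, hjl]
      · have hz : T i j l = 0 := hT i h
        simp [hz, hjl]
  -- `diag(t^j) * M t i = T i * diag(t^j)` for every `t`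
  have hconj : ∀ (t : ℂ) (i : Fin k),
      Matrix.diagonal (fun j : Fin (a i) => t ^ j.val) * M t i =
        T i * Matrix.diagonal (fun j : Fin (a i) => t ^ j.val) := by
    intro t i; ext j l
    simp only [Matrix.diagonal_mul, Matrix.mul_diagonal, hM, Matrix.of_apply]
    by_cases h : l < j
    · have hz : T i j l = 0 := hT i h
      simp [hz]
    · have hle : j.val ≤ l.val := not_lt.mp h
      rw [mul_left_comm, ← pow_add, Nat.add_sub_cancel' hle]
  -- conjugation invariance: `charpoly (r (M t)) = charpoly (r T)` for `t ≠ 0`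
  have hkey : ∀ t : ℂ, t ≠ 0 → (r (M t)).charpoly = (r T).charpoly := by
    intro t ht
    set D : (i : Fin k) → Matrix (Fin (a i)) (Fin (a i)) ℂ :=
      fun i => Matrix.diagonal fun j => t ^ j.val with hD
    set D' : (i : Fin k) → Matrix (Fin (a i)) (Fin (a i)) ℂ :=
      fun i => Matrix.diagonal fun j => (t ^ j.val)⁻¹ with hD'
    have hDD' : D * D' = 1 := by
      funext i
      simp only [Pi.mul_apply, hD, hD', Matrix.diagonal_mul_diagonal, Pi.one_apply]
      rw [← Matrix.diagonal_one]; congr 1; funext j; exact mul_inv_cancel₀ (pow_ne_zero _ ht)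
    have hD'D : D' * D = 1 := by
      funext i
      simp only [Pi.mul_apply, hD, hD', Matrix.diagonal_mul_diagonal, Pi.one_apply]
      rw [← Matrix.diagonal_one]; congr 1; funext j; exact inv_mul_cancel₀ (pow_ne_zero _ ht)
    have hDu : ∀ i, IsUnit (D i) := fun i =>
      isUnit_iff_exists.2 ⟨D' i, by simpa using congr_fun hDD' i, by simpa using congr_fun hD'D i⟩
    have hD'u : ∀ i, IsUnit (D' i) := fun i =>
      isUnit_iff_exists.2 ⟨D i, by simpa using congr_fun hD'D i, by simpa using congr_fun hDD' i⟩
    have hMt : M t = D' * (T * D) := by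
      funext i
      have h2 : D' i * D i = 1 := by simpa using congr_fun hD'D i
      calc M t i = D' i * (D i * M t i) := by rw [← mul_assoc, h2, one_mul]
        _ = D' i * (T i * D i) := by congr 1; exact hconj t i
        _ = (D' * (T * D)) i := by simp only [Pi.mul_apply]
    have hTD : ∀ i, IsUnit ((T * D) i) := fun i => (hTu i).mul (hDu i)
    have e1 : r (M t) = r D' * (r T * r D) := by
      rw [hMt, hmul _ _ hD'u hTD, hmul _ _ hTu hDu]
    have e2 : r D * r D' = 1 := by rw [← hmul _ _ hDu hD'u, hDD', h1]
    rw [e1]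
    exact charpoly_conj_of_mul_eq_one _ _ _ e2
  -- polynomial dependence on `t`
  set Q : Matrix (Fin n) (Fin n) ℂ[X] := Matrix.of fun s u =>
    MvPolynomial.aeval (fun x : (i : Fin k) × (Fin (a i) × Fin (a i)) =>
      Polynomial.C (T x.1 x.2.1 x.2.2) * Polynomial.X ^ (x.2.2.val - x.2.1.val)) (P s u) with hQ
  have hQeval : ∀ t : ℂ, Q.map (Polynomial.evalRingHom t) = r (M t) := by
    intro t; ext s u
    simp only [Matrix.map_apply, hQ, Matrix.of_apply, hr, Polynomial.coe_evalRingHom]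
    rw [← Polynomial.coe_aeval_eq_eval, ← AlgHom.comp_apply, MvPolynomial.comp_aeval,
      ← MvPolynomial.aeval_eq_eval]
    congr 2
    funext x
    simp [hM]
  have hcp : ∀ t : ℂ, (r (M t)).charpoly = Q.charpoly.map (Polynomial.evalRingHom t) := by
    intro t; rw [← hQeval t, Matrix.charpoly_map]
  -- conclusion
  suffices h : (r (M 1)).charpoly = (r (M 0)).charpoly by rwa [hM1, hM0] at h
  apply Polynomial.ext
  intro m
  have hconst : ∀ t : ℂ, (Q.charpoly.coeff m).eval t = (r T).charpoly.coeff m := by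
    have hc : Q.charpoly.coeff m - Polynomial.C ((r T).charpoly.coeff m) = 0 := by
      apply Polynomial.eq_zero_of_infinite_isRoot
      refine Set.Infinite.mono (s := ({0}ᶜ : Set ℂ)) ?_ (Set.finite_singleton (0 : ℂ)).infinite_compl
      intro t ht
      have ht0 : t ≠ 0 := ht
      have h2 := congrArg (fun p : ℂ[X] => p.coeff m) (hkey t ht0)
      simp only [hcp t, Polynomial.coeff_map, Polynomial.coe_evalRingHom] at h2
      simp only [Set.mem_setOf_eq, Polynomial.IsRoot.def, Polynomial.eval_sub, Polynomial.eval_C,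
        h2, sub_self]
    intro t
    have h3 := congrArg (Polynomial.eval t) hc
    simpa [sub_eq_zero] using h3
  rw [hcp 1, hcp 0, Polynomial.coeff_map, Polynomial.coeff_map, Polynomial.coe_evalRingHom,
    Polynomial.coe_evalRingHom, hconst, hconst]

/-- **The characteristic polynomial of `r g` only depends on the eigenvalues of the `gᵢ`.**  For
invertible `gᵢ ∈ M_{aᵢ}(ℂ)` whose eigenvalues are listed with multiplicity, in any order, by
`dᵢ : Fin aᵢ → ℂ`, `charpoly (r g) = charpoly (r (diagonal dᵢ)ᵢ)`.  Schur triangularization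
with prescribed diagonal (Horn–Johnson Thm. 2.3.1), conjugation invariance and the torus
degeneration `charpoly_apply_eq_of_blockTriangular`. [cite: HornJohnson2013, Thm. 2.3.1] -/
theorem charpoly_apply_eq_charpoly_apply_diagonal
    (P : Fin n → Fin n → MvPolynomial ((i : Fin k) × (Fin (a i) × Fin (a i))) ℂ)
    (r : ((i : Fin k) → Matrix (Fin (a i)) (Fin (a i)) ℂ) → Matrix (Fin n) (Fin n) ℂ)
    (hr : ∀ (M : (i : Fin k) → Matrix (Fin (a i)) (Fin (a i)) ℂ) (s t : Fin n),
      r M s t = MvPolynomial.eval (fun x => M x.1 x.2.1 x.2.2) (P s t))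
    (h1 : r 1 = 1)
    (hmul : ∀ M N : (i : Fin k) → Matrix (Fin (a i)) (Fin (a i)) ℂ,
      (∀ i, IsUnit (M i)) → (∀ i, IsUnit (N i)) → r (M * N) = r M * r N)
    (g : (i : Fin k) → Matrix (Fin (a i)) (Fin (a i)) ℂ) (hg : ∀ i, IsUnit (g i))
    (d : (i : Fin k) → Fin (a i) → ℂ)
    (hd : ∀ i, Finset.univ.val.map (d i) = (g i).charpoly.roots) :
    (r g).charpoly = (r fun i => Matrix.diagonal (d i)).charpoly := by
  classical
  choose U hU hUT hUd using fun i =>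
    Literature.LinearAlgebra.Matrix.exists_unitaryGroup_conj_upperTriangular_of_roots_eq
      (g i) (d i) (hd i)
  have hU1 : ∀ i, star (U i) * U i = 1 := fun i => Matrix.mem_unitaryGroup_iff'.mp (hU i)
  have hU2 : ∀ i, U i * star (U i) = 1 := fun i => Matrix.mem_unitaryGroup_iff.mp (hU i)
  have hUu : ∀ i, IsUnit (U i) := fun i => isUnit_iff_exists.2 ⟨star (U i), hU2 i, hU1 i⟩
  have hU'u : ∀ i, IsUnit (star (U i)) := fun i => isUnit_iff_exists.2 ⟨U i, hU1 i, hU2 i⟩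
  set T : (i : Fin k) → Matrix (Fin (a i)) (Fin (a i)) ℂ := fun i => star (U i) * g i * U i
    with hTdef
  have hTu : ∀ i, IsUnit (T i) := fun i => ((hU'u i).mul (hg i)).mul (hUu i)
  have hgT : g = (fun i => U i) * (T * fun i => star (U i)) := by
    funext i
    simp only [Pi.mul_apply, hTdef]
    calc g i = (U i * star (U i)) * g i * (U i * star (U i)) := by rw [hU2 i, one_mul, mul_one]
      _ = U i * (star (U i) * g i * U i * star (U i)) := by simp only [mul_assoc]
  have hTU : ∀ i, IsUnit ((T * fun i => star (U i)) i) := fun i => (hTu i).mul (hU'u i)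
  have e1 : r g = r (fun i => U i) * (r T * r fun i => star (U i)) := by
    rw [hgT, hmul _ _ hUu hTU, hmul _ _ hTu hU'u]
  have e2 : (r fun i => star (U i)) * r (fun i => U i) = 1 := by
    rw [← hmul _ _ hU'u hUu]
    have : ((fun i => star (U i)) * fun i => U i) = (1 : (i : Fin k) → Matrix _ _ ℂ) :=
      funext fun i => hU1 i
    rw [this, h1]
  rw [e1, charpoly_conj_of_mul_eq_one _ _ _ e2,
    charpoly_apply_eq_of_blockTriangular P r hr h1 hmul T hUT hTu]
  congr 2
  funext i
  congr 1
  funext j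
  exact hUd i j

/-- **Characteristic polynomial of the inverse.**  For an invertible `A ∈ M_m(ℂ)`,
`charpoly A⁻¹ = ∏_{b ∈ roots (charpoly A)} (X - b⁻¹)`: in a Schur form `A = U T U⋆`
(Horn–Johnson Thm. 2.3.1) one has `T⁻¹ = U⋆ A⁻¹ U` upper triangular
(Mathlib `Matrix.blockTriangular_inv_of_blockTriangular`) with diagonal the inverses of that of
`T`. [cite: HornJohnson2013, Thm. 2.3.1] -/
theorem charpoly_inv_eq_prod_roots {m : ℕ} (A : Matrix (Fin m) (Fin m) ℂ) (hA : IsUnit A) :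
    A⁻¹.charpoly = (A.charpoly.roots.map fun b => X - C b⁻¹).prod := by
  classical
  have hcard : Multiset.card A.charpoly.roots = m := by
    rw [← (IsAlgClosed.splits A.charpoly).natDegree_eq_card_roots,
      Matrix.charpoly_natDegree_eq_dim, Fintype.card_fin]
  obtain ⟨d, hd⟩ := exists_univ_val_map_eq A.charpoly.roots hcard
  obtain ⟨U, hU, hT, hTd⟩ :=
    Literature.LinearAlgebra.Matrix.exists_unitaryGroup_conj_upperTriangular_of_roots_eq A d hd
  have hU1 : star U * U = 1 := Matrix.mem_unitaryGroup_iff'.mp hU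
  have hU2 : U * star U = 1 := Matrix.mem_unitaryGroup_iff.mp hU
  set T := star U * A * U with hTdef
  have hTu : IsUnit T :=
    ((isUnit_iff_exists.2 ⟨U, hU1, hU2⟩).mul hA).mul (isUnit_iff_exists.2 ⟨star U, hU2, hU1⟩)
  -- `T⁻¹ = U⋆ A⁻¹ U`
  have hUinv : U⁻¹ = star U := Matrix.inv_eq_left_inv hU1
  have hU'inv : (star U)⁻¹ = U := Matrix.inv_eq_left_inv hU2
  have hTinv : T⁻¹ = star U * (A⁻¹ * U) := by
    rw [hTdef, Matrix.mul_inv_rev, Matrix.mul_inv_rev, hUinv, hU'inv]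
  have hcpT : T⁻¹.charpoly = A⁻¹.charpoly := by
    rw [hTinv]; exact charpoly_conj_of_mul_eq_one _ _ _ hU2
  -- `T⁻¹` is upper triangular with diagonal `(d j)⁻¹`
  haveI : Invertible T := hTu.invertible
  have hTi : T⁻¹.BlockTriangular id := Matrix.blockTriangular_inv_of_blockTriangular hT
  have hTT : T * T⁻¹ = 1 := Matrix.mul_nonsing_inv T ((Matrix.isUnit_iff_isUnit_det T).mp hTu)
  have hdiag : ∀ j, T⁻¹ j j = (d j)⁻¹ := by
    intro j
    have h := congr_fun (congr_fun hTT j) j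
    rw [Matrix.mul_apply, Matrix.one_apply_eq, Finset.sum_eq_single j] at h
    · rw [hTd j] at h
      exact (inv_eq_of_mul_eq_one_right h).symm
    · intro l _ hl
      rcases lt_or_gt_of_ne hl with h' | h'
      · rw [hT h', zero_mul]
      · rw [hTi h', mul_zero]
    · intro h'; exact absurd (Finset.mem_univ j) h'
  rw [← hcpT, Matrix.charpoly_of_upperTriangular _ hTi, ← hd, Multiset.map_map,
    Finset.prod_eq_multiset_prod]
  congr 1
  refine Multiset.map_congr rfl fun j _ => ?_
  simp [hdiag j]

/-! ### Transport of `r` along a ring isomorphism `ι : L ≃+* ℂ` -/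

/-- **Transport.**  For `ι : L ≃+* ℂ`, the map `r_L` with entries
`eval (entries of M) (ι⁻¹ P)` satisfies `ι (r_L M) = r (ι M)` entrywise. [folklore] -/
theorem map_apply_transport {L : Type*} [Field L] (ι : L ≃+* ℂ)
    (P : Fin n → Fin n → MvPolynomial ((i : Fin k) × (Fin (a i) × Fin (a i))) ℂ)
    (r : ((i : Fin k) → Matrix (Fin (a i)) (Fin (a i)) ℂ) → Matrix (Fin n) (Fin n) ℂ)
    (hr : ∀ (M : (i : Fin k) → Matrix (Fin (a i)) (Fin (a i)) ℂ) (s t : Fin n),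
      r M s t = MvPolynomial.eval (fun x => M x.1 x.2.1 x.2.2) (P s t))
    (M : (i : Fin k) → Matrix (Fin (a i)) (Fin (a i)) L) :
    (Matrix.of fun s t => MvPolynomial.eval (fun x => M x.1 x.2.1 x.2.2)
        (MvPolynomial.map (ι.symm : ℂ →+* L) (P s t))).map (ι : L →+* ℂ) =
      r fun i => (M i).map (ι : L →+* ℂ) := by
  ext s t
  rw [Matrix.map_apply, Matrix.of_apply, hr, MvPolynomial.eval_map, MvPolynomial.eval₂_comp_left,
    RingEquiv.comp_symm]
  rfl

/-- The transported map takes `1` to `1` (injectivity of `ι`). [folklore] -/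
theorem transport_one {L : Type*} [Field L] (ι : L ≃+* ℂ)
    (P : Fin n → Fin n → MvPolynomial ((i : Fin k) × (Fin (a i) × Fin (a i))) ℂ)
    (r : ((i : Fin k) → Matrix (Fin (a i)) (Fin (a i)) ℂ) → Matrix (Fin n) (Fin n) ℂ)
    (hr : ∀ (M : (i : Fin k) → Matrix (Fin (a i)) (Fin (a i)) ℂ) (s t : Fin n),
      r M s t = MvPolynomial.eval (fun x => M x.1 x.2.1 x.2.2) (P s t))
    (h1 : r 1 = 1) :
    (Matrix.of fun s t => MvPolynomial.eval
        (fun x => (1 : (i : Fin k) → Matrix (Fin (a i)) (Fin (a i)) L) x.1 x.2.1 x.2.2)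
        (MvPolynomial.map (ι.symm : ℂ →+* L) (P s t))) = 1 := by
  apply Matrix.map_injective (ι : L →+* ℂ).injective
  dsimp only
  rw [map_apply_transport ι P r hr]
  have e : (fun i => ((1 : (i : Fin k) → Matrix (Fin (a i)) (Fin (a i)) L) i).map
      (ι : L →+* ℂ)) = 1 := by
    funext i
    rw [Pi.one_apply, ← RingHom.mapMatrix_apply, map_one, Pi.one_apply]
  rw [e, h1, ← RingHom.mapMatrix_apply, map_one]

/-- The transported map is multiplicative on tuples of invertible matrices (injectivity of `ι`;
`ι` preserves invertibility). [folklore] -/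
theorem transport_mul {L : Type*} [Field L] (ι : L ≃+* ℂ)
    (P : Fin n → Fin n → MvPolynomial ((i : Fin k) × (Fin (a i) × Fin (a i))) ℂ)
    (r : ((i : Fin k) → Matrix (Fin (a i)) (Fin (a i)) ℂ) → Matrix (Fin n) (Fin n) ℂ)
    (hr : ∀ (M : (i : Fin k) → Matrix (Fin (a i)) (Fin (a i)) ℂ) (s t : Fin n),
      r M s t = MvPolynomial.eval (fun x => M x.1 x.2.1 x.2.2) (P s t))
    (hmul : ∀ M N : (i : Fin k) → Matrix (Fin (a i)) (Fin (a i)) ℂ,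
      (∀ i, IsUnit (M i)) → (∀ i, IsUnit (N i)) → r (M * N) = r M * r N)
    (M N : (i : Fin k) → Matrix (Fin (a i)) (Fin (a i)) L)
    (hM : ∀ i, IsUnit (M i)) (hN : ∀ i, IsUnit (N i)) :
    (Matrix.of fun s t => MvPolynomial.eval (fun x => (M * N) x.1 x.2.1 x.2.2)
        (MvPolynomial.map (ι.symm : ℂ →+* L) (P s t))) =
      (Matrix.of fun s t => MvPolynomial.eval (fun x => M x.1 x.2.1 x.2.2)
        (MvPolynomial.map (ι.symm : ℂ →+* L) (P s t))) *
      (Matrix.of fun s t => MvPolynomial.eval (fun x => N x.1 x.2.1 x.2.2)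
        (MvPolynomial.map (ι.symm : ℂ →+* L) (P s t))) := by
  apply Matrix.map_injective (ι : L →+* ℂ).injective
  dsimp only
  rw [Matrix.map_mul, map_apply_transport ι P r hr, map_apply_transport ι P r hr,
    map_apply_transport ι P r hr]
  have hMι : ∀ i, IsUnit ((M i).map (ι : L →+* ℂ)) := fun i => by
    rw [← RingHom.mapMatrix_apply]; exact (hM i).map _
  have hNι : ∀ i, IsUnit ((N i).map (ι : L →+* ℂ)) := fun i => by
    rw [← RingHom.mapMatrix_apply]; exact (hN i).map _
  rw [← hmul _ _ hMι hNι]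
  congr 1
  funext i
  rw [Pi.mul_apply, Pi.mul_apply, Matrix.map_mul]

/-- **Transport, packaged.**  For `ι : L ≃+* ℂ` there are `P_L` (namely `ι⁻¹ P`) and
`r_L : ∏ᵢ M_{aᵢ}(L) → M_n(L)` with polynomial entries given by `P_L`, `r_L 1 = 1`, multiplicative on
invertible tuples, and `ι (r_L M) = r (ι M)`.  (Packaging the three previous lemmas so that users
never spell out `r_L`.) [folklore] -/
theorem exists_transport {L : Type*} [Field L] (ι : L ≃+* ℂ)
    (P : Fin n → Fin n → MvPolynomial ((i : Fin k) × (Fin (a i) × Fin (a i))) ℂ)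
    (r : ((i : Fin k) → Matrix (Fin (a i)) (Fin (a i)) ℂ) → Matrix (Fin n) (Fin n) ℂ)
    (hr : ∀ (M : (i : Fin k) → Matrix (Fin (a i)) (Fin (a i)) ℂ) (s t : Fin n),
      r M s t = MvPolynomial.eval (fun x => M x.1 x.2.1 x.2.2) (P s t))
    (h1 : r 1 = 1)
    (hmul : ∀ M N : (i : Fin k) → Matrix (Fin (a i)) (Fin (a i)) ℂ,
      (∀ i, IsUnit (M i)) → (∀ i, IsUnit (N i)) → r (M * N) = r M * r N) :
    ∃ (Pl : Fin n → Fin n → MvPolynomial ((i : Fin k) × (Fin (a i) × Fin (a i))) L)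
      (rl : ((i : Fin k) → Matrix (Fin (a i)) (Fin (a i)) L) → Matrix (Fin n) (Fin n) L),
      (∀ (M : (i : Fin k) → Matrix (Fin (a i)) (Fin (a i)) L) (s t : Fin n),
          rl M s t = MvPolynomial.eval (fun x => M x.1 x.2.1 x.2.2) (Pl s t)) ∧
      rl 1 = 1 ∧
      (∀ M N : (i : Fin k) → Matrix (Fin (a i)) (Fin (a i)) L,
          (∀ i, IsUnit (M i)) → (∀ i, IsUnit (N i)) → rl (M * N) = rl M * rl N) ∧
      ∀ M : (i : Fin k) → Matrix (Fin (a i)) (Fin (a i)) L,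
          (rl M).map (ι : L →+* ℂ) = r fun i => (M i).map (ι : L →+* ℂ) := by
  refine ⟨fun s t => MvPolynomial.map (ι.symm : ℂ →+* L) (P s t),
    fun M => Matrix.of fun s t => MvPolynomial.eval (fun x => M x.1 x.2.1 x.2.2)
      (MvPolynomial.map (ι.symm : ℂ →+* L) (P s t)), ?_, ?_, ?_, ?_⟩
  · intro M s t; simp only [Matrix.of_apply]
  · exact transport_one ι P r hr h1
  · exact transport_mul ι P r hr hmul
  · exact map_apply_transport ι P r hr

end Summit.Langlands.Langlands.Theorems.PolynomialFunctorTransportKit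

end
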